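import Literature.GroupTheory.ArithmeticGroups.SL2Mod8SchurMultiplier
import Literature.GroupTheory.ArithmeticGroups.SL2TwoPowTopLayerExp2
import Literature.GroupTheory.ArithmeticGroups.SL2TwoPowSchurMultiplier
import HarnessLib

/-!
# The `2`-part of the Schur multiplier of `SL₂(ℤ/2^e)`: all levels `e ≥ 3`

We complete the `2`-adic descent.  `SL2TwoPowSchurMultiplier.step` needs the commutation of `e_h = t^a` and
`f_h = l^a` (`a = 2^{e-2}`), proved there for `e ≥ 5` by a parity argument.  Here we prove it for every `e ≥ 4`
UNDER THE HYPOTHESIS `τ = t^{2^e} = 1`: `[t^a, l⁴] = [t^a, l²] · l²[t^a, l²]l⁻² = c²` where `c = [t^a, l²]` lies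
over the central scalar `(1+ϖ)·1`, so that `g ↦ [g, c]` is a homomorphism into the kernel and `l²` centralises
`c`; and `c² = 1` because the top-layer preimage is abelian of exponent `2` when `τ = 1`
(`sq_eq_one_of_layer₂`, all `e ≥ 3`).  Consequently `P(e-1) ⟹ P(e)` for every `e ≥ 4` (`P_succ`), and with the
base `P(3)` (`SL2Mod8.eq_one_of_tau_eq_one`):

* `eq_one_of_tau_eq_one` (**`P(e)` for all `e ≥ 3`**): a central extension of `SL₂(ℤ/2^e)` with kernel of
  exponent `2` and a lift `t` of `T̄` with `t^{2^e} = 1` has `ker ∩ [E, E] = 1`;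
* `mem_zpowers_tau` (`e ≥ 5`): in general `ker ∩ [E, E] ⊆ ⟨t^{2^e}⟩`.

This is the `2`-primary counterpart of [Beyl1986] needed for the `SL₂(ℤ)`-invariant form of
[CalegariDimitrovTang2025, Corollary 4.5.3] at levels `4 ∣ N`.
-/

open scoped MatrixGroups commutatorElement

universe u

namespace Literature.GroupTheory.ArithmeticGroups

namespace SL2TwoPowSchurMultiplierAll

open Matrix.SpecialLinearGroup SL2TwoPowTopLayerExp2

variable {e : ℕ} {E : Type u} [Group E] {π : E →* SL(2, ZMod (2 ^ e))}

section doubleLayer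

variable (hcen : ∀ z : E, π z = 1 → ∀ g : E, g * z = z * g) (hK2 : ∀ z : E, π z = 1 → z ^ 2 = 1)
variable {t l eh fh xh : E} (heh : eh = t ^ 2 ^ (e - 2)) (hfh : fh = l ^ 2 ^ (e - 2)) (hxh : xh = t * fh * t⁻¹)
  (ht : ((π t : SL(2, ZMod (2 ^ e))) : Matrix (Fin 2) (Fin 2) (ZMod (2 ^ e))) = !![1, 1; 0, 1])
  (hl : ((π l : SL(2, ZMod (2 ^ e))) : Matrix (Fin 2) (Fin 2) (ZMod (2 ^ e))) = !![1, 0; 1, 1])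

include hcen hK2 heh hfh ht hl in
/-- **`e_h` and `f_h` commute for every `e ≥ 4` when `t^{2^e} = 1`.**  With `c = [t^a, l²]` (over the central
scalar `1 + ϖ`): `[t^a, l⁴] = c · l² c l⁻² = c² = 1` (the top-layer preimage has exponent `2`), and
`[t^a, l^a] = [t^a, l⁴]^{a/4}`. [cite: Beyl1986, Theorem (Schur multiplier of SL(2,ℤ/m)), 2-primary part] -/
theorem commute_eh_fh_of_tau (he : 4 ≤ e) (hτ : t ^ 2 ^ e = 1) : Commute eh fh := by
  haveI : Fact (Nat.Prime 2) := ⟨Nat.prime_two⟩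
  have ha := SL2DoubleLayer.a_mul_a e he
  have ha4 := SL2DoubleLayer.four_mul_a e (by omega)
  have hTa := SL2TwoPowCentralExtension.coe_map_eh (π := π) heh ht
  -- `c = [e_h, l²]` lies over the central scalar `(1+ϖ 0; 0 1-ϖ)`
  have hc_coe : ((π ⁅eh, l ^ 2⁆ : SL(2, ZMod (2 ^ e))) : Matrix (Fin 2) (Fin 2) (ZMod (2 ^ e))) =
      !![1 + (2 : ZMod (2 ^ e)) ^ (e - 1), 0; 0, 1 - (2 : ZMod (2 ^ e)) ^ (e - 1)] := by
    rw [map_commutatorElement, map_pow, coe_ta_comm_lBar_sq ha ha4 (π eh) (π l) hTa hl,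
      SL2DoubleLayer.two_mul_a e (by omega)]
  have h2ϖ : 2 * (2 : ZMod (2 ^ e)) ^ (e - 1) = 0 := by
    have h : ((2 * 2 ^ (e - 1) : ℕ) : ZMod (2 ^ e)) = 0 := by
      rw [ZMod.natCast_eq_zero_iff, ← pow_succ', show e - 1 + 1 = e by omega]
    exact_mod_cast h
  set c : E := ⁅eh, l ^ 2⁆ with hc
  have hcc : ∀ g h : E, h * ⁅g, c⁆ = ⁅g, c⁆ * h := by
    intro g h
    refine hcen _ ?_ h
    rw [map_commutatorElement, commutatorElement_eq_one_iff_mul_comm]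
    exact comm_of_coe_diag h2ϖ _ hc_coe (π g)
  -- `l²` centralises `c`
  have hl2c : ⁅l ^ 2, c⁆ = 1 := by
    rw [pow_two, SL2Mod8.comm_mul_left_of_central hcc, ← pow_two]
    exact hK2 _ (by
      rw [map_commutatorElement, commutatorElement_eq_one_iff_mul_comm]
      exact comm_of_coe_diag h2ϖ _ hc_coe (π l))
  -- `c` lies over the top layer, so `c² = 1`
  set e₀ : E := t ^ 2 ^ (e - 1) with he₀
  set f₀ : E := l ^ 2 ^ (e - 1) with hf₀
  set h₁ : E := t * f₀ * t⁻¹ * f₀⁻¹ * e₀ with hh₁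
  have hlay_c : Matrix.SpecialLinearGroup.map (ZMod.castHom (pow_dvd_pow 2 (Nat.sub_le e 1))
      (ZMod (2 ^ (e - 1)))) (π c) = 1 := by
    have key := SL2TopLayer.map_castHom_eq_one_of_coe 2 e (π c) (x00 := 1) (x01 := 0) (x10 := 0)
      (x11 := -1)
    simp only [Nat.cast_ofNat] at key
    apply key
    rw [hc_coe]
    ext i j; fin_cases i <;> fin_cases j <;> simp
    all_goals ring
  have hc2 : c * c = 1 :=
    sq_eq_one_of_layer₂ hcen hK2 he₀ hf₀ hh₁ ht hl (by omega) hτ hlay_c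
  -- `[e_h, l⁴] = c · l² c l⁻² = c² = 1`
  have hl4 : ⁅eh, l ^ 4⁆ = 1 := by
    rw [show l ^ 4 = l ^ 2 * l ^ 2 by rw [← pow_add], SL2Mod8.comm_mul_right, ← hc]
    have : l ^ 2 * c * (l ^ 2)⁻¹ = c := by
      rw [(commutatorElement_eq_one_iff_mul_comm.mp hl2c), mul_inv_cancel_right]
    rw [this, hc2]
  -- `[e_h, f_h] = [e_h, l⁴]^{2^{e-4}} = 1`
  have hpow : fh = (l ^ 4) ^ 2 ^ (e - 4) := by
    rw [hfh, ← pow_mul]; congr 1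
    rw [show e - 2 = 2 + (e - 4) by omega, pow_add]; norm_num
  have hc1 : ∀ g : E, g * ⁅eh, l ^ 4⁆ = ⁅eh, l ^ 4⁆ * g := fun g ↦ by rw [hl4, mul_one, one_mul]
  rw [← commutatorElement_eq_one_iff_commute, hpow, SL2TwoPowCentralExtension.commutatorElement_pow_right hc1,
    hl4, one_pow]

include heh hxh in
/-- `e_h` and `x_h` commute, given `Commute e_h f_h`. [cite: Beyl1986, Theorem (Schur multiplier of
SL(2,ℤ/m)), 2-primary part] -/
theorem commute_eh_xh' (hef : Commute eh fh) : Commute eh xh := by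
  have het : Commute eh t := by rw [heh]; exact (Commute.refl t).pow_left _
  rw [hxh]
  exact (het.mul_right hef).mul_right het.inv_right

include hcen heh hfh hxh ht hl in
/-- `f_h` and `x_h` commute, given `Commute e_h f_h`. [cite: Beyl1986, Theorem (Schur multiplier of
SL(2,ℤ/m)), 2-primary part] -/
theorem commute_fh_xh' (hef : Commute eh fh) : Commute fh xh := by
  set y : E := l * eh * l⁻¹ with hy
  have hu : π (y * xh) = 1 := by
    rw [hy, map_mul, map_mul, map_mul, map_inv]
    exact SL2DoubleLayer.lBar_conj_ta_mul_xa _ (π l) (π eh) (π xh) hl (SL2TwoPowCentralExtension.coe_map_eh heh ht)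
      (SL2TwoPowCentralExtension.coe_map_xh hfh hxh ht hl)
  have hxy : xh = y⁻¹ * (y * xh) := by group
  have hfl : Commute fh l := by rw [hfh]; exact (Commute.refl l).pow_left _
  have hfy : Commute fh y := by
    rw [hy]; exact (hfl.mul_right hef.symm).mul_right hfl.inv_right
  have hfu : Commute fh (y * xh) := (hcen _ hu fh)
  rw [hxy]
  exact hfy.inv_right.mul_right hfu

include hcen heh hfh hxh ht hl in
/-- A generator commutes with every `e_h^i f_h^j x_h^k z` (given `Commute e_h f_h`). [cite: Beyl1986, Theorem
(Schur multiplier of SL(2,ℤ/m)), 2-primary part] -/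
theorem commute_decomp' (hef : Commute eh fh) {v : E} (hv : v = eh ∨ v = fh ∨ v = xh) (i j k : ℕ) {z : E}
    (hz : π z = 1) : Commute v (eh ^ i * fh ^ j * xh ^ k * z) := by
  have hex := commute_eh_xh' heh hxh hef
  have hfx := commute_fh_xh' hcen heh hfh hxh ht hl hef
  have hvz : Commute v z := (hcen z hz v)
  rcases hv with rfl | rfl | rfl
  · exact ((((Commute.refl v).pow_right i).mul_right (hef.pow_right j)).mul_right (hex.pow_right k)).mul_right hvz
  · exact ((((hef.symm).pow_right i).mul_right ((Commute.refl v).pow_right j)).mul_right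
      (hfx.pow_right k)).mul_right hvz
  · exact ((((hex.symm).pow_right i).mul_right (hfx.symm.pow_right j)).mul_right
      ((Commute.refl v).pow_right k)).mul_right hvz

include hcen heh hfh hxh ht hl in
/-- The double-layer preimage is abelian (given `Commute e_h f_h`, `e ≥ 4`). [cite: Beyl1986, Theorem (Schur
multiplier of SL(2,ℤ/m)), 2-primary part] -/
theorem comm_of_double_layer' (he : 4 ≤ e) (hef : Commute eh fh) {x y : E}
    (hx : Matrix.SpecialLinearGroup.map (ZMod.castHom (pow_dvd_pow 2 (Nat.sub_le e 2)) (ZMod (2 ^ (e - 2))))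
      (π x) = 1)
    (hy : Matrix.SpecialLinearGroup.map (ZMod.castHom (pow_dvd_pow 2 (Nat.sub_le e 2)) (ZMod (2 ^ (e - 2))))
      (π y) = 1) : x * y = y * x := by
  obtain ⟨i, j, k, z, hz, rfl⟩ := SL2TwoPowCentralExtension.exists_decomp₂ heh hfh hxh ht hl he hx
  obtain ⟨i', j', k', z', hz', rfl⟩ := SL2TwoPowCentralExtension.exists_decomp₂ heh hfh hxh ht hl he hy
  have h1 := commute_decomp' hcen heh hfh hxh ht hl hef (Or.inl rfl) i' j' k' hz'
  have h2 := commute_decomp' hcen heh hfh hxh ht hl hef (Or.inr (Or.inl rfl)) i' j' k' hz'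
  have h3 := commute_decomp' hcen heh hfh hxh ht hl hef (Or.inr (Or.inr rfl)) i' j' k' hz'
  have h4 : Commute z (eh ^ i' * fh ^ j' * xh ^ k' * z') := (hcen z hz _).symm
  exact (((h1.pow_left i).mul_left (h2.pow_left j)).mul_left (h3.pow_left k)).mul_left h4

include hcen hK2 heh hfh hxh ht hl in
/-- Squares in the double layer (given `Commute e_h f_h`). [cite: Beyl1986, Theorem (Schur multiplier of
SL(2,ℤ/m)), 2-primary part] -/
theorem sq_decomp' (hef : Commute eh fh) (i j k : ℕ) {z : E} (hz : π z = 1) :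
    (eh ^ i * fh ^ j * xh ^ k * z) * (eh ^ i * fh ^ j * xh ^ k * z) =
      eh ^ (2 * i) * fh ^ (2 * j) * xh ^ (2 * k) := by
  have hex := commute_eh_xh' heh hxh hef
  have hfx := commute_fh_xh' hcen heh hfh hxh ht hl hef
  have hz2 : z * z = 1 := by rw [← pow_two]; exact hK2 z hz
  have hzc : ∀ g : E, Commute z g := fun g ↦ (hcen z hz g).symm
  have h1 : (eh ^ i * fh ^ j * xh ^ k * z) * (eh ^ i * fh ^ j * xh ^ k * z) =
      (eh ^ i * fh ^ j * xh ^ k) * (eh ^ i * fh ^ j * xh ^ k) * (z * z) := by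
    have := (hzc (eh ^ i * fh ^ j * xh ^ k)).eq
    calc (eh ^ i * fh ^ j * xh ^ k * z) * (eh ^ i * fh ^ j * xh ^ k * z)
        = (eh ^ i * fh ^ j * xh ^ k) * (z * (eh ^ i * fh ^ j * xh ^ k)) * z := by group
      _ = (eh ^ i * fh ^ j * xh ^ k) * ((eh ^ i * fh ^ j * xh ^ k) * z) * z := by rw [this]
      _ = (eh ^ i * fh ^ j * xh ^ k) * (eh ^ i * fh ^ j * xh ^ k) * (z * z) := by group
  have hAB : Commute (eh ^ i) (fh ^ j) := hef.pow_pow i j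
  have hAC : Commute (eh ^ i) (xh ^ k) := hex.pow_pow i k
  have hBC : Commute (fh ^ j) (xh ^ k) := hfx.pow_pow j k
  rw [h1, hz2, mul_one, ← pow_two, (hAC.mul_left hBC).mul_pow, hAB.mul_pow, ← pow_mul, ← pow_mul, ← pow_mul,
    mul_comm i 2, mul_comm j 2, mul_comm k 2]

include hcen hK2 heh hfh hxh ht hl in
/-- A square `x²`, `x` over the double layer, lying in `ker π` is a power of `τ = t^{2^e}` (`e ≥ 4`, given
`Commute e_h f_h`). [cite: Beyl1986, Theorem (Schur multiplier of SL(2,ℤ/m)), 2-primary part] -/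
theorem sq_mem_zpowers' (he : 4 ≤ e) (hef : Commute eh fh) {x : E}
    (hx : Matrix.SpecialLinearGroup.map (ZMod.castHom (pow_dvd_pow 2 (Nat.sub_le e 2)) (ZMod (2 ^ (e - 2))))
      (π x) = 1)
    (h1 : π (x * x) = 1) : x * x ∈ Subgroup.zpowers (t ^ 2 ^ e) := by
  obtain ⟨i, j, k, z, hz, rfl⟩ := SL2TwoPowCentralExtension.exists_decomp₂ heh hfh hxh ht hl he hx
  rw [sq_decomp' hcen hK2 heh hfh hxh ht hl hef i j k hz] at h1 ⊢
  have h2 : π eh ^ (2 * i) * π fh ^ (2 * j) * π xh ^ (2 * k) = 1 := by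
    rw [← map_pow, ← map_pow, ← map_pow, ← map_mul, ← map_mul]; exact h1
  obtain ⟨⟨i', rfl⟩, ⟨j', rfl⟩, ⟨k', rfl⟩⟩ := SL2DoubleLayer.even_of_pow_mul_pow_mul_pow_eq_one e he
    (π eh) (π fh) (π xh) (SL2TwoPowCentralExtension.coe_map_eh heh ht)
    (SL2TwoPowCentralExtension.coe_map_fh hfh hl) (SL2TwoPowCentralExtension.coe_map_xh hfh hxh ht hl) h2
  have hpow : 2 ^ (e - 2) * (2 * (2 * 1)) = 2 ^ e := by
    rw [show e = e - 2 + 2 by omega, pow_add]; norm_num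
  have heh4 : ∀ n : ℕ, eh ^ (2 * (2 * n)) = (t ^ 2 ^ e) ^ n := by
    intro n
    rw [heh, ← pow_mul, ← pow_mul, show 2 ^ (e - 2) * (2 * (2 * n)) = 2 ^ (e - 2) * (2 * (2 * 1)) * n by ring,
      hpow]
  have hfh4 : ∀ n : ℕ, fh ^ (2 * (2 * n)) = (l ^ 2 ^ e) ^ n := by
    intro n
    rw [hfh, ← pow_mul, ← pow_mul, show 2 ^ (e - 2) * (2 * (2 * n)) = 2 ^ (e - 2) * (2 * (2 * 1)) * n by ring,
      hpow]
  have hxh4 : ∀ n : ℕ, xh ^ (2 * (2 * n)) = (l ^ 2 ^ e) ^ n := by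
    intro n
    rw [hxh, conj_pow, hfh4 n, hcen _ (by rw [map_pow, SL2TwoPowCentralExtension.map_lpow hl, one_pow]) t,
      mul_assoc, mul_inv_cancel, mul_one]
  rw [heh4, hfh4, hxh4, SL2TwoPowCentralExtension.lpow_eq_tau_inv hcen hK2 ht hl (by omega), inv_pow, inv_pow]
  exact mul_mem (mul_mem (Subgroup.npow_mem_zpowers (t ^ 2 ^ e) i')
    (inv_mem (Subgroup.npow_mem_zpowers (t ^ 2 ^ e) j'))) (inv_mem (Subgroup.npow_mem_zpowers (t ^ 2 ^ e) k'))

end doubleLayer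

/-! ### The descent step for all `e ≥ 4` (under `τ = 1`) and the final theorems -/

/-- **`P(e-1) ⟹ P(e)` for every `e ≥ 4`**, where `P(n)` says: every central extension of `SL₂(ℤ/2ⁿ)` with
kernel of exponent `2` and a lift `t` of `T̄` with `t^{2ⁿ} = 1` has `ker ∩ [E, E] = 1`. [cite: Beyl1986, Theorem
(Schur multiplier of SL(2,ℤ/m)), 2-primary part] -/
theorem P_succ (e : ℕ) (he : 4 ≤ e)
    (IH : ∀ (E' : Type u) [Group E'] (π' : E' →* SL(2, ZMod (2 ^ (e - 1)))), Function.Surjective π' →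
      (∀ z : E', π' z = 1 → ∀ g : E', g * z = z * g) → (∀ z : E', π' z = 1 → z ^ 2 = 1) →
      ∀ t' : E', ((π' t' : SL(2, ZMod (2 ^ (e - 1)))) : Matrix (Fin 2) (Fin 2) (ZMod (2 ^ (e - 1)))) =
        !![1, 1; 0, 1] → t' ^ 2 ^ (e - 1) = 1 →
      ∀ z : E', π' z = 1 → z ∈ commutator E' → z = 1)
    {E : Type u} [Group E] (π : E →* SL(2, ZMod (2 ^ e))) (hsurj : Function.Surjective π)
    (hcen : ∀ z : E, π z = 1 → ∀ g : E, g * z = z * g) (hK2 : ∀ z : E, π z = 1 → z ^ 2 = 1) (t : E)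
    (ht : ((π t : SL(2, ZMod (2 ^ e))) : Matrix (Fin 2) (Fin 2) (ZMod (2 ^ e))) = !![1, 1; 0, 1])
    (hτ : t ^ 2 ^ e = 1) : ∀ z : E, π z = 1 → z ∈ commutator E → z = 1 := by
  haveI : NeZero (2 ^ (e - 1)) := ⟨pow_ne_zero _ two_ne_zero⟩
  obtain ⟨l, hl'⟩ := hsurj ⟨!![1, 0; 1, 1], by simp [Matrix.det_fin_two_of]⟩
  have hl : ((π l : SL(2, ZMod (2 ^ e))) : Matrix (Fin 2) (Fin 2) (ZMod (2 ^ e))) = !![1, 0; 1, 1] := by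
    rw [hl']
  set eh : E := t ^ 2 ^ (e - 2) with heh
  set fh : E := l ^ 2 ^ (e - 2) with hfh
  set xh : E := t * fh * t⁻¹ with hxh
  have hef : Commute eh fh := commute_eh_fh_of_tau hcen hK2 heh hfh ht hl he hτ
  set r₂ := Matrix.SpecialLinearGroup.map (n := Fin 2)
    (ZMod.castHom (pow_dvd_pow 2 (Nat.sub_le e 2)) (ZMod (2 ^ (e - 2)))) with hr₂
  set r₁ := Matrix.SpecialLinearGroup.map (n := Fin 2)
    (ZMod.castHom (pow_dvd_pow 2 (Nat.sub_le e 1)) (ZMod (2 ^ (e - 1)))) with hr₁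
  have hmulA : ∀ x y : E, r₂ (π x) = 1 → r₂ (π y) = 1 → r₂ (π (x * y)) = 1 := fun x y hx hy ↦ by
    rw [map_mul, map_mul, hx, hy, mul_one]
  have hinvA : ∀ x : E, r₂ (π x) = 1 → r₂ (π x⁻¹) = 1 := fun x hx ↦ by rw [map_inv, map_inv, hx, inv_one]
  have hconjA : ∀ g x : E, r₂ (π x) = 1 → r₂ (π (g * x * g⁻¹)) = 1 := fun g x hx ↦ by
    rw [map_mul, map_mul, map_mul, map_mul, hx, mul_one, map_inv, map_inv, mul_inv_cancel]
  have hcommA : ∀ x y : E, r₂ (π x) = 1 → r₂ (π y) = 1 → x * y = y * x := fun x y hx hy ↦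
    comm_of_double_layer' hcen heh hfh hxh ht hl he hef hx hy
  let W : Subgroup E :=
    { carrier := {w | ∃ x : E, r₂ (π x) = 1 ∧ x * x = w}
      one_mem' := ⟨1, by rw [map_one, map_one], one_mul 1⟩
      mul_mem' := by
        rintro _ _ ⟨x, hx, rfl⟩ ⟨y, hy, rfl⟩
        refine ⟨x * y, hmulA x y hx hy, ?_⟩
        calc x * y * (x * y) = x * (y * x) * y := by group
          _ = x * (x * y) * y := by rw [hcommA y x hy hx]
          _ = x * x * (y * y) := by group
      inv_mem' := by
        rintro _ ⟨x, hx, rfl⟩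
        exact ⟨x⁻¹, hinvA x hx, by group⟩ }
  have hWmem : ∀ w, w ∈ W ↔ ∃ x : E, r₂ (π x) = 1 ∧ x * x = w := fun w ↦ Iff.rfl
  haveI hWn : W.Normal := ⟨by
    intro w hw g
    obtain ⟨x, hx, rfl⟩ := (hWmem w).mp hw
    exact (hWmem _).mpr ⟨g * x * g⁻¹, hconjA g x hx, by group⟩⟩
  have hehA : r₂ (π eh) = 1 := SL2TwoPowCentralExtension.layer₂_eh heh ht
  have hfhA : r₂ (π fh) = 1 := by
    have hcast : ZMod.castHom (pow_dvd_pow 2 (Nat.sub_le e 2)) (ZMod (2 ^ (e - 2))) ((2 : ZMod (2 ^ e)) ^ (e - 2)) = 0 := by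
      rw [map_pow, map_ofNat]
      have : ((2 ^ (e - 2) : ℕ) : ZMod (2 ^ (e - 2))) = 0 := ZMod.natCast_self _
      exact_mod_cast this
    rw [hr₂]
    ext i j; fin_cases i <;> fin_cases j <;>
      simp [SL2TwoPowCentralExtension.coe_map_fh hfh hl, -ZMod.castHom_apply, map_one, hcast]
  have hxhA : r₂ (π xh) = 1 := by rw [hxh]; exact hconjA t fh hfhA
  have hehW : eh * eh ∈ W := (hWmem _).mpr ⟨eh, hehA, rfl⟩
  have hfhW : fh * fh ∈ W := (hWmem _).mpr ⟨fh, hfhA, rfl⟩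
  have hxhW : xh * xh ∈ W := (hWmem _).mpr ⟨xh, hxhA, rfl⟩
  have hh0W : xh ^ 2 * eh ^ 2 * (fh ^ 2)⁻¹ ∈ W := by
    rw [pow_two, pow_two, pow_two]
    exact mul_mem (mul_mem hxhW hehW) (inv_mem hfhW)
  have hWker : W ≤ (r₁.comp π).ker := by
    intro w hw
    obtain ⟨x, hx, rfl⟩ := (hWmem w).mp hw
    obtain ⟨i, j, k, z, hz, rfl⟩ := SL2TwoPowCentralExtension.exists_decomp₂ heh hfh hxh ht hl he hx
    have hπ2 : π (eh ^ (2 * i) * fh ^ (2 * j) * xh ^ (2 * k)) = π eh ^ (2 * i) * π fh ^ (2 * j) * π xh ^ (2 * k) := by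
      simp only [map_mul, map_pow]
    rw [MonoidHom.mem_ker, MonoidHom.comp_apply, sq_decomp' hcen hK2 heh hfh hxh ht hl hef i j k hz, hπ2, hr₁]
    exact SL2DoubleLayer.map_castHom_pow_mul_pow_mul_pow_eq_one e he (π eh) (π fh) (π xh)
      (SL2TwoPowCentralExtension.coe_map_eh heh ht) (SL2TwoPowCentralExtension.coe_map_fh hfh hl)
      (SL2TwoPowCentralExtension.coe_map_xh hfh hxh ht hl) i j k
  let π' : E ⧸ W →* SL(2, ZMod (2 ^ (e - 1))) := QuotientGroup.lift W (r₁.comp π) hWker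
  have hπ' : ∀ x : E, π' (QuotientGroup.mk x) = r₁ (π x) := fun x ↦ rfl
  have hsurj' : Function.Surjective π' := by
    intro y
    obtain ⟨Y, hY⟩ := SL2TopLayer.map_castHom_surjective (2 ^ e) (pow_dvd_pow 2 (Nat.sub_le e 1)) y
    obtain ⟨x, hx⟩ := hsurj Y
    exact ⟨QuotientGroup.mk x, by rw [hπ', hx]; exact hY⟩
  have hker' : ∀ x : E, π' (QuotientGroup.mk x) = 1 → ∃ z : E, π z = 1 ∧ (QuotientGroup.mk x : E ⧸ W) =
      QuotientGroup.mk z := by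
    intro x hx
    rw [hπ'] at hx
    obtain ⟨a, b, c, z, hz, hxz⟩ := SL2TwoPowCentralExtension.exists_decomp₁ heh hfh hxh ht hl he hx
    have hxW : (eh ^ 2) ^ b * (xh ^ 2 * eh ^ 2 * (fh ^ 2)⁻¹) ^ a * (fh ^ 2) ^ c ∈ W := by
      refine mul_mem (mul_mem (pow_mem ?_ _) (pow_mem hh0W _)) (pow_mem ?_ _)
      · rw [pow_two]; exact hehW
      · rw [pow_two]; exact hfhW
    refine ⟨z, hz, ?_⟩
    rw [hxz, QuotientGroup.mk_mul, (QuotientGroup.eq_one_iff _).mpr hxW, one_mul]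
  have hcen' : ∀ q : E ⧸ W, π' q = 1 → ∀ g : E ⧸ W, g * q = q * g := by
    intro q hq g
    induction q using QuotientGroup.induction_on with
    | H x =>
      induction g using QuotientGroup.induction_on with
      | H y =>
        obtain ⟨z, hz, hxz⟩ := hker' x hq
        rw [hxz, ← QuotientGroup.mk_mul, ← QuotientGroup.mk_mul, hcen z hz y]
  have hK2' : ∀ q : E ⧸ W, π' q = 1 → q ^ 2 = 1 := by
    intro q hq
    induction q using QuotientGroup.induction_on with
    | H x =>
      obtain ⟨z, hz, hxz⟩ := hker' x hq
      rw [hxz, ← QuotientGroup.mk_pow, hK2 z hz, QuotientGroup.mk_one]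
  have ht' : ((π' (QuotientGroup.mk t) : SL(2, ZMod (2 ^ (e - 1)))) :
      Matrix (Fin 2) (Fin 2) (ZMod (2 ^ (e - 1)))) = !![1, 1; 0, 1] := by
    rw [hπ', hr₁]
    ext i j; fin_cases i <;> fin_cases j <;> simp [ht, -ZMod.castHom_apply, map_one]
  have htpow : (QuotientGroup.mk t : E ⧸ W) ^ 2 ^ (e - 1) = 1 := by
    rw [← QuotientGroup.mk_pow, SL2TwoPowCentralExtension.pow_half_eq_eh_sq heh (by omega),
      QuotientGroup.eq_one_iff]
    exact hehW
  intro z hz hzc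
  have h1 : π' (QuotientGroup.mk z) = 1 := by rw [hπ', hz, map_one]
  have h2 : (QuotientGroup.mk z : E ⧸ W) ∈ commutator (E ⧸ W) := by
    have := Subgroup.mem_map_of_mem (QuotientGroup.mk' W) hzc
    rw [commutator_def, Subgroup.map_commutator] at this
    rw [commutator_def]
    exact Subgroup.commutator_mono le_top le_top this
  have h3 := IH (E ⧸ W) π' hsurj' hcen' hK2' _ ht' htpow _ h1 h2
  have h4 : z ∈ W := (QuotientGroup.eq_one_iff z).mp h3
  obtain ⟨x, hx, hxz⟩ := (hWmem z).mp h4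
  rw [← hxz] at hz ⊢
  have h5 := sq_mem_zpowers' hcen hK2 heh hfh hxh ht hl he hef hx hz
  rw [hτ, Subgroup.zpowers_one_eq_bot, Subgroup.mem_bot] at h5
  exact h5

/-- **`P(3 + n)` for every `n`**: the `2`-adic descent from the base `SL₂(ℤ/8)`. [cite: Beyl1986, Theorem
(Schur multiplier of SL(2,ℤ/m)), 2-primary part] -/
theorem forall_P (n : ℕ) :
    ∀ (E : Type u) [Group E] (π : E →* SL(2, ZMod (2 ^ (3 + n)))), Function.Surjective π →
      (∀ z : E, π z = 1 → ∀ g : E, g * z = z * g) → (∀ z : E, π z = 1 → z ^ 2 = 1) →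
      ∀ t : E, ((π t : SL(2, ZMod (2 ^ (3 + n)))) : Matrix (Fin 2) (Fin 2) (ZMod (2 ^ (3 + n)))) =
        !![1, 1; 0, 1] → t ^ 2 ^ (3 + n) = 1 → ∀ z : E, π z = 1 → z ∈ commutator E → z = 1 := by
  induction n with
  | zero => intro E _ π hsurj hcen hK2 t ht hτ; exact SL2Mod8.eq_one_of_tau_eq_one π hsurj hcen hK2 t ht hτ
  | succ n ih =>
    intro E _ π hsurj hcen hK2 t ht hτ
    have h := P_succ (3 + (n + 1)) (by omega)
    rw [show 3 + (n + 1) - 1 = 3 + n by omega] at h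
    exact h ih π hsurj hcen hK2 t ht hτ

/-- **Theorem (`2`-primary Schur multiplier bound for `SL₂(ℤ/2^e)`, all `e ≥ 3`).**  Let `π : E ↠ SL₂(ℤ/2^e)`
be a central extension whose kernel has exponent `2`, `t ∈ E` a lift of `T̄ = (1 1; 0 1)` with `t^{2^e} = 1`.
Then `ker π ∩ [E, E] = 1`. [cite: Beyl1986, Theorem (Schur multiplier of SL(2,ℤ/m)), 2-primary part] -/
theorem eq_one_of_tau_eq_one (e : ℕ) (he : 3 ≤ e) {E : Type u} [Group E] (π : E →* SL(2, ZMod (2 ^ e)))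
    (hsurj : Function.Surjective π) (hcen : ∀ z : E, π z = 1 → ∀ g : E, g * z = z * g)
    (hK2 : ∀ z : E, π z = 1 → z ^ 2 = 1) (t : E)
    (ht : ((π t : SL(2, ZMod (2 ^ e))) : Matrix (Fin 2) (Fin 2) (ZMod (2 ^ e))) = !![1, 1; 0, 1])
    (hτ : t ^ 2 ^ e = 1) {z : E} (hz : π z = 1) (hzc : z ∈ commutator E) : z = 1 := by
  obtain ⟨n, rfl⟩ := Nat.exists_eq_add_of_le he
  exact forall_P n E π hsurj hcen hK2 t ht hτ z hz hzc

/-- **`ker π ∩ [E, E] ⊆ ⟨t^{2^e}⟩`** for every central extension of `SL₂(ℤ/2^e)` (`e ≥ 5`) with kernel of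
exponent `2` and every lift `t` of `T̄`. [cite: Beyl1986, Theorem (Schur multiplier of SL(2,ℤ/m)), 2-primary
part] -/
theorem mem_zpowers_tau (e : ℕ) (he : 5 ≤ e) {E : Type u} [Group E] (π : E →* SL(2, ZMod (2 ^ e)))
    (hsurj : Function.Surjective π) (hcen : ∀ z : E, π z = 1 → ∀ g : E, g * z = z * g)
    (hK2 : ∀ z : E, π z = 1 → z ^ 2 = 1) (t : E)
    (ht : ((π t : SL(2, ZMod (2 ^ e))) : Matrix (Fin 2) (Fin 2) (ZMod (2 ^ e))) = !![1, 1; 0, 1])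
    {z : E} (hz : π z = 1) (hzc : z ∈ commutator E) : z ∈ Subgroup.zpowers (t ^ 2 ^ e) := by
  have h := forall_P (e - 1 - 3)
  rw [show 3 + (e - 1 - 3) = e - 1 by omega] at h
  exact SL2TwoPowSchurMultiplier.step e he π hsurj hcen hK2 h t ht z hz hzc

end SL2TwoPowSchurMultiplierAll

end Literature.GroupTheory.ArithmeticGroups
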